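import Summits.CriticalPhenomena.CardyFormulaZ2.Theorems.CardyComplexConeParafermionToSLESixFamiliesIicDefs
import Literature.Probability.Percolation.LatticeSymmetry
import Literature.Probability.Percolation.PlanarDuality
import Literature.Probability.Percolation.BernoulliPercolation
import HarnessLib

/-!
# Hardness certificate for stub S2 of line `iic-trace-flux-pairing` (crux `ParafermionToSLESixFamilies`,
stmt-CriticalPhenomena-11389, route `CardyComplexCone`)

The registered stub `stub_halfPlaneOneArmLower : HalfPlaneOneArmLower` (…IicDefs) asserts the sharp LOWER bound
`π₁⁺(n) ≥ c · n^{-1/3}` (eventually) for the half-plane one-arm probability of critical bond percolation on `ℤ²`,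
stated for the half-box `[-n, n] × [0, n]` around the origin. This file proves, unconditionally and sorry-free,
that it implies — with `ε = 1/6` — the statement

  `∃ ε > 0, ∃ C > 0, ∀ n ≥ 1, n^{-1/2 + ε} ≤ C · P_{1/2}[(n,0) ↔ left ∪ right ∪ top side inside [0,2n] × [0,n]]`,

which is VERBATIM the former crux `Summit.CriticalPhenomena.CardyFormulaZ2.Theses.QuarterTurnNoGo.StrictHalfPlaneOneArm`
(stmt-CriticalPhenomena-5036, "β₁⁺ < 1/2 on bond-ℤ²"; recorded there: "no strict half-plane arm inequality is in print
for ℤ², and β₁⁺ = 1/2 is excluded by no known ℤ² estimate"). So S2 is at least as strong as a polynomial improvement of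
the only rigorous bound `π₁⁺(n) ≥ c · n^{-1/2}` (Harris–FKG + universal half-plane two-arm exponent), which is itself
not known: the kernel-checked form of the death certificate `Lines/iic-trace-flux-pairing-dead.md`.

Ingredients: the half-box event of S2 is the translate by `(n, 0)` of the rectangle crossing event
(`real_openCrossing_shift`, translation invariance of `P_p`); the crossing event has positive probability at every `n`
(the open vertical column `(n,0) … (n,n)`, probability `2^{-n}`, `bondPercolation_real_setOf_subset`), which absorbs
the finitely many `n` before the eventual range of S2 into the constant.
-/

noncomputable section

namespace Summit.CriticalPhenomena.CardyFormulaZ2.Cruxes.ParafermionToSLESixFamilies.IicTraceFluxPairing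

open Filter MeasureTheory Set
open Literature.Probability.LatticeModels Literature.Probability.Percolation

/-- Changing the target set outside the ambient set `S` does not change a crossing event inside `S` (the
endpoint of an open path inside `S` lies in `S`). -/
theorem openCrossing_congr_target {V : Type*} {S A B B' : Set V} (h : ∀ y ∈ S, (y ∈ B ↔ y ∈ B')) :
    openCrossing S A B = openCrossing S A B' := by
  ext ω
  simp only [mem_openCrossing_iff]
  constructor
  · rintro ⟨x, hx, y, hy, hω⟩
    obtain ⟨hxS, hyS, hr⟩ := hω
    exact ⟨x, hx, y, (h y hyS).1 hy, ⟨hxS, hyS, hr⟩⟩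
  · rintro ⟨x, hx, y, hy, hω⟩
    obtain ⟨hxS, hyS, hr⟩ := hω
    exact ⟨x, hx, y, (h y hyS).2 hy, ⟨hxS, hyS, hr⟩⟩

/-- The half-box one-arm event of S2, as a crossing event from `{0}` to the three far sides. -/
theorem halfBoxArm_eq_openCrossing (n : ℕ) :
    {ω : BondConfig (Site 2) | ∃ y : Site 2, (y 0 = (n : ℤ) ∨ y 0 = -(n : ℤ) ∨ y 1 = (n : ℤ)) ∧
        ω ∈ openConnIn {v : Site 2 | 0 ≤ v 1 ∧ -(n : ℤ) ≤ v 0 ∧ v 0 ≤ n ∧ v 1 ≤ n} 0 y}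
      = openCrossing {v : Site 2 | 0 ≤ v 1 ∧ -(n : ℤ) ≤ v 0 ∧ v 0 ≤ n ∧ v 1 ≤ n} {0}
          {y : Site 2 | y 0 = (n : ℤ) ∨ y 0 = -(n : ℤ) ∨ y 1 = (n : ℤ)} := by
  ext ω
  simp only [mem_setOf_eq, mem_openCrossing_iff, mem_singleton_iff, exists_eq_left]

/-- The half-box `[-n, n] × [0, n]` translated by `(n, 0)` is the lattice rectangle `[0, 2n] × [0, n]`. -/
theorem image_add_halfBox (n : ℕ) :
    (fun u : Site 2 => u + ![(n : ℤ), 0]) '' {v : Site 2 | 0 ≤ v 1 ∧ -(n : ℤ) ≤ v 0 ∧ v 0 ≤ n ∧ v 1 ≤ n}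
      = (↑(rectangle (2 * n) n) : Set (Site 2)) := by
  ext x
  simp only [mem_image, mem_setOf_eq, Finset.mem_coe, mem_rectangle_iff]
  constructor
  · rintro ⟨u, ⟨h1, h2, h3, h4⟩, rfl⟩
    simp only [Pi.add_apply, Matrix.cons_val_zero, Matrix.cons_val_one, Matrix.cons_val_fin_one]
    push_cast
    omega
  · rintro ⟨h1, h2, h3, h4⟩
    refine ⟨x - ![(n : ℤ), 0], ?_, sub_add_cancel _ _⟩
    simp only [Pi.sub_apply, Matrix.cons_val_zero, Matrix.cons_val_one, Matrix.cons_val_fin_one]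
    push_cast at h2
    omega

/-- The origin translated by `(n, 0)`. -/
theorem image_add_singleton_zero (n : ℕ) :
    (fun u : Site 2 => u + ![(n : ℤ), 0]) '' ({0} : Set (Site 2)) = {![(n : ℤ), 0]} := by
  rw [image_singleton, zero_add]

/-- On the rectangle `[0, 2n] × [0, n]`, the translate of the far boundary `{y₀ = ±n} ∪ {y₁ = n}` of the half-box is
the union of the left, right and top sides. -/
theorem mem_image_add_farSides_iff (n : ℕ) (y : Site 2) (hy : y ∈ (↑(rectangle (2 * n) n) : Set (Site 2))) :
    y ∈ (fun u : Site 2 => u + ![(n : ℤ), 0]) '' {y : Site 2 | y 0 = (n : ℤ) ∨ y 0 = -(n : ℤ) ∨ y 1 = (n : ℤ)} ↔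
      y ∈ (↑(leftSide (2 * n) n) ∪ ↑(rightSide (2 * n) n) ∪ ↑(topSide (2 * n) n) : Set (Site 2)) := by
  rw [Finset.mem_coe] at hy
  have hy' := hy
  rw [mem_rectangle_iff] at hy'
  obtain ⟨h1, h2, h3, h4⟩ := hy'
  simp only [mem_image, mem_setOf_eq, mem_union, Finset.mem_coe, leftSide, rightSide, topSide,
    Finset.mem_filter, hy, true_and]
  constructor
  · rintro ⟨u, hu, rfl⟩
    simp only [Pi.add_apply, Matrix.cons_val_zero, Matrix.cons_val_one, Matrix.cons_val_fin_one] at h1 h2 h3 h4 ⊢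
    push_cast at h2 ⊢
    omega
  · intro h
    refine ⟨y - ![(n : ℤ), 0], ?_, sub_add_cancel _ _⟩
    simp only [Pi.sub_apply, Matrix.cons_val_zero, Matrix.cons_val_one, Matrix.cons_val_fin_one]
    push_cast at h2 h
    omega

/-- **The half-box one-arm probability of S2 equals the rectangle crossing probability of
`QuarterTurnNoGo.StrictHalfPlaneOneArm`** (translation by `(n, 0)`). -/
theorem real_halfBoxArm_eq_real_rectangleArm (n : ℕ) :
    (bondPercolation (zdGraph 2) half).real
        {ω : BondConfig (Site 2) | ∃ y : Site 2, (y 0 = (n : ℤ) ∨ y 0 = -(n : ℤ) ∨ y 1 = (n : ℤ)) ∧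
          ω ∈ openConnIn {v : Site 2 | 0 ≤ v 1 ∧ -(n : ℤ) ≤ v 0 ∧ v 0 ≤ n ∧ v 1 ≤ n} 0 y}
      = (bondPercolation (zdGraph 2) half).real
        (openCrossing (↑(rectangle (2 * n) n) : Set (Site 2)) {![(n : ℤ), 0]}
          (↑(leftSide (2 * n) n) ∪ ↑(rightSide (2 * n) n) ∪ ↑(topSide (2 * n) n))) := by
  rw [halfBoxArm_eq_openCrossing,
    ← real_openCrossing_shift half (![(n : ℤ), 0] : Site 2)
      {v : Site 2 | 0 ≤ v 1 ∧ -(n : ℤ) ≤ v 0 ∧ v 0 ≤ n ∧ v 1 ≤ n} ({0} : Set (Site 2))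
      {y : Site 2 | y 0 = (n : ℤ) ∨ y 0 = -(n : ℤ) ∨ y 1 = (n : ℤ)},
    image_add_halfBox, image_add_singleton_zero,
    openCrossing_congr_target (mem_image_add_farSides_iff n)]

/-- The lattice point `(n, j)` lies in the rectangle `[0, 2n] × [0, n]` for `j ≤ n`. -/
theorem colPoint_mem_rectangle (n : ℕ) {j : ℤ} (hj0 : 0 ≤ j) (hjn : j ≤ n) :
    (![(n : ℤ), j] : Site 2) ∈ (↑(rectangle (2 * n) n) : Set (Site 2)) := by
  rw [Finset.mem_coe, mem_rectangle_iff]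
  simp only [Matrix.cons_val_zero, Matrix.cons_val_one, Matrix.cons_val_fin_one]
  push_cast
  omega

/-- If the `j` column edges `(n, i) — (n, i+1)`, `i < j`, are open then `(n, 0) ↔ (n, j)` inside the rectangle. -/
theorem openConnIn_column {ω : BondConfig (Site 2)} (n : ℕ) :
    ∀ j : ℕ, j ≤ n → (∀ i : ℕ, i < j → s((![(n : ℤ), (i : ℤ)] : Site 2), ![(n : ℤ), (i : ℤ) + 1]) ∈ ω) →
      ω ∈ openConnIn (↑(rectangle (2 * n) n) : Set (Site 2)) ![(n : ℤ), 0] ![(n : ℤ), (j : ℤ)] := by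
  intro j
  induction j with
  | zero =>
    intro _ _
    simpa using openConnIn_refl (ω := ω) (colPoint_mem_rectangle n (j := 0) le_rfl (by positivity))
  | succ j ih =>
    intro hj hF
    have h1 := ih (by omega) (fun i hi => hF i (by omega))
    have h2 : ω ∈ openConnIn (↑(rectangle (2 * n) n) : Set (Site 2)) ![(n : ℤ), (j : ℤ)]
        ![(n : ℤ), ((j + 1 : ℕ) : ℤ)] := by
      push_cast
      refine openConnIn_of_adj (colPoint_mem_rectangle n (by positivity) (by omega))
        (colPoint_mem_rectangle n (by positivity) (by omega)) (hF j (by omega)) ?_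
      intro heq
      have := congr_fun heq 1
      simp at this
    exact PlanarDuality.openConnIn_trans h1 h2

/-- **Positivity**: the rectangle arm event has probability at least `2^{-n} > 0` (open vertical column from
`(n, 0)` to the top side). -/
theorem real_rectangleArm_pos (n : ℕ) :
    0 < (bondPercolation (zdGraph 2) half).real
        (openCrossing (↑(rectangle (2 * n) n) : Set (Site 2)) {![(n : ℤ), 0]}
          (↑(leftSide (2 * n) n) ∪ ↑(rightSide (2 * n) n) ∪ ↑(topSide (2 * n) n))) := by
  classical
  set F : Finset (Sym2 (Site 2)) :=
    (Finset.range n).image fun i : ℕ => s((![(n : ℤ), (i : ℤ)] : Site 2), ![(n : ℤ), (i : ℤ) + 1]) with hFdef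
  have hFE : (↑F : Set (Sym2 (Site 2))) ⊆ (zdGraph 2).edgeSet := by
    intro e he
    rw [hFdef, Finset.coe_image, Set.mem_image] at he
    obtain ⟨i, -, rfl⟩ := he
    rw [SimpleGraph.mem_edgeSet, zdGraph_adj_iff]
    refine ⟨1, Or.inl ?_⟩
    funext k
    fin_cases k <;> simp
  have hsub : {ω : BondConfig (Site 2) | (↑F : Set (Sym2 (Site 2))) ⊆ ω} ⊆
      openCrossing (↑(rectangle (2 * n) n) : Set (Site 2)) {![(n : ℤ), 0]}
        (↑(leftSide (2 * n) n) ∪ ↑(rightSide (2 * n) n) ∪ ↑(topSide (2 * n) n)) := by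
    intro ω hω
    rw [mem_openCrossing_iff]
    refine ⟨![(n : ℤ), 0], rfl, ![(n : ℤ), (n : ℤ)], ?_, ?_⟩
    · refine Or.inr ?_
      rw [Finset.mem_coe, topSide, Finset.mem_filter]
      exact ⟨colPoint_mem_rectangle n (by positivity) le_rfl, by simp⟩
    · refine openConnIn_column n n le_rfl (fun i hi => hω ?_)
      rw [Finset.mem_coe, hFdef, Finset.mem_image]
      exact ⟨i, Finset.mem_range.2 hi, rfl⟩
  calc (0 : ℝ) < ((half : unitInterval) : ℝ) ^ F.card := by rw [coe_half]; positivity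
    _ = (bondPercolation (zdGraph 2) half).real {ω : BondConfig (Site 2) | (↑F : Set (Sym2 (Site 2))) ⊆ ω} :=
        (bondPercolation_real_setOf_subset _ half F hFE).symm
    _ ≤ _ := measureReal_mono hsub (measure_ne_top _ _)

/-- **Hardness certificate for S2.** The registered stub statement `HalfPlaneOneArmLower` of line
`iic-trace-flux-pairing` implies, with `ε = 1/6`, the polynomial improvement `β₁⁺ < 1/2` of the half-plane one-arm
exponent of bond-`ℤ²` percolation in the exact form of `QuarterTurnNoGo.StrictHalfPlaneOneArm`
(stmt-CriticalPhenomena-5036) — an estimate that is not known on `ℤ²`. -/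
theorem strictHalfPlaneOneArm_of_halfPlaneOneArmLower :
    HalfPlaneOneArmLower → ∃ ε : ℝ, 0 < ε ∧ ∃ C : ℝ, 0 < C ∧ ∀ n : ℕ, 1 ≤ n →
      (n : ℝ) ^ (-(1 / 2 : ℝ) + ε) ≤ C * (bondPercolation (zdGraph 2) half).real
        (openCrossing (↑(rectangle (2 * n) n) : Set (Site 2)) {![(n : ℤ), 0]}
          (↑(leftSide (2 * n) n) ∪ ↑(rightSide (2 * n) n) ∪ ↑(topSide (2 * n) n))) := by
  rintro ⟨c, hc, hev⟩
  rw [Filter.eventually_atTop] at hev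
  obtain ⟨N, hN⟩ := hev
  -- the rectangle arm probability and the compensating constants below the eventual range
  set P : ℕ → ℝ := fun n => (bondPercolation (zdGraph 2) half).real
    (openCrossing (↑(rectangle (2 * n) n) : Set (Site 2)) {![(n : ℤ), 0]}
      (↑(leftSide (2 * n) n) ∪ ↑(rightSide (2 * n) n) ∪ ↑(topSide (2 * n) n))) with hP
  have hPpos : ∀ n, 0 < P n := fun n => real_rectangleArm_pos n
  set g : ℕ → ℝ := fun n => (n : ℝ) ^ (-((1 : ℝ) / 3)) / P n with hg
  have hg0 : ∀ n, 0 ≤ g n := fun n => div_nonneg (Real.rpow_nonneg (Nat.cast_nonneg n) _) (hPpos n).le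
  refine ⟨1 / 6, by norm_num, 1 / c + ∑ k ∈ Finset.range N, g k, ?_, ?_⟩
  · have : 0 ≤ ∑ k ∈ Finset.range N, g k := Finset.sum_nonneg fun k _ => hg0 k
    positivity
  intro n _hn
  have hexp : (n : ℝ) ^ (-(1 / 2 : ℝ) + 1 / 6) = (n : ℝ) ^ (-((1 : ℝ) / 3)) := by norm_num
  rw [hexp]
  have hsum0 : 0 ≤ ∑ k ∈ Finset.range N, g k := Finset.sum_nonneg fun k _ => hg0 k
  rcases Nat.lt_or_ge n N with hnN | hNn
  · -- finitely many small `n`: absorbed by positivity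
    have h1 : (n : ℝ) ^ (-((1 : ℝ) / 3)) = g n * P n := by
      rw [hg]
      field_simp [(hPpos n).ne']
    have h2 : g n ≤ ∑ k ∈ Finset.range N, g k :=
      Finset.single_le_sum (fun k _ => hg0 k) (Finset.mem_range.2 hnN)
    calc (n : ℝ) ^ (-((1 : ℝ) / 3)) = g n * P n := h1
      _ ≤ (1 / c + ∑ k ∈ Finset.range N, g k) * P n := by
          gcongr
          have : 0 < 1 / c := by positivity
          linarith
  · -- eventual range: S2 itself, transported to the rectangle
    have h1 : c * (n : ℝ) ^ (-((1 : ℝ) / 3)) ≤ P n := by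
      have := hN n hNn
      rwa [real_halfBoxArm_eq_real_rectangleArm] at this
    have h2 : (n : ℝ) ^ (-((1 : ℝ) / 3)) ≤ 1 / c * P n := by
      rw [div_mul_eq_mul_div, le_div_iff₀ hc, mul_comm]
      linarith
    calc (n : ℝ) ^ (-((1 : ℝ) / 3)) ≤ 1 / c * P n := h2
      _ ≤ (1 / c + ∑ k ∈ Finset.range N, g k) * P n := by
          gcongr
          linarith

end Summit.CriticalPhenomena.CardyFormulaZ2.Cruxes.ParafermionToSLESixFamilies.IicTraceFluxPairing

end
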